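import Literature.Computability.AlgebraicComplexity.BorderRankMatMul223Cert
import Literature.Computability.AlgebraicComplexity.BorderApolarityTests
import Literature.Computability.AlgebraicComplexity.GradedInitialSubspace
import HarnessLib

/-!
# The weight lines of `M_⟨223⟩(C*)^⊥` and the torus degeneration of a subspace (for `R̲(⟨2,2,3⟩) ≥ 10`)

Topic `Literature/Computability/AlgebraicComplexity`.  Sibling of
`BorderRankMatMul223Apolarity.lean` (support for the discharge of `ConnerHarperLandsberg2023_thm_1_3`),
the `⟨2,2,3⟩` transplant of the tree's `BorderRankMatMulTwoWeights.lean`: the `M_⟨223⟩`-specific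
linear algebra of the torus normal form in the border apolarity method (Conner–Harper–Landsberg
2023, §2.4–§2.5 and §4, §7.2: "`A* ⊗ B* = U ⊗ 𝔰𝔩(V) ⊗ W* ⊕ U ⊗ Id_V ⊗ W*` … `M(C*) = U* ⊗ Id_V ⊗ W`"),
PROVED:

* kernel-decided combinatorics of the `18` weight lines `ω_k` (`wvZ`, `wdeg`, from
  `BorderRankMatMul223Cert.lean`) for the grading `deg2` (`kOf`, `partner`, windows, `wdegIdx`);
* `mem_annSub_matMul_iff`, `projDeg_mem_annSub` — `M_⟨223⟩(C*)^⊥ = {φ : φ(X_{i0}Y_{0k}) + φ(X_{i1}Y_{1k}) = 0}`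
  is graded, and `exists_wv_eq_smul` — its graded pieces are the weight LINES;
* `finrank_le_card_weightLines` — **a subspace `F ≤ M_⟨223⟩(C*)^⊥` degenerates onto `≥ dim F`
  weight lines**: `|{k : ω_k ∈ in_{wdeg k}(F)}| ≥ dim F` (`GradedInitialSubspace.lean`);
* `mul210_mem_Vge`, `projDeg_mul210`, `mul120_mem_Vge`, `projDeg_mul120` — the test products are
  homogeneous of degrees `degA a₀`, `degB b₀` (inputs of `map_inPart_le`).

## References

* A. Conner, A. Harper, J. M. Landsberg, *New lower bounds for matrix multiplication and `det₃`*,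
  Forum Math. Pi 11 (2023) e17 = arXiv:1911.07981, §2.4–§2.5, §4, §7.2.
  [ConnerHarperLandsberg2023]
-/

noncomputable section

open scoped BigOperators Polynomial
open Polynomial

namespace Literature.Computability.AlgebraicComplexity

namespace MatMul223

universe u

/-! ## Combinatorics of the `18` weight lines (kernel-decided) -/

/-- The weight line through the coordinate `s` of `A* ⊗ B*` (a monomial line off the diagonal
`j ≠ j'`, a binomial line on it). [cite: ConnerHarperLandsberg2023, §4 and §7.2] -/
def kOf (s : A2 × B23) : Fin 18 :=
  match encS s with
  | 3 => 0 | 4 => 1 | 5 => 2 | 6 => 3 | 7 => 4 | 8 => 5 | 15 => 6 | 16 => 7 | 17 => 8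
  | 18 => 9 | 19 => 10 | 20 => 11 | 0 => 12 | 9 => 12 | 1 => 13 | 10 => 13 | 2 => 14
  | 11 => 14 | 12 => 15 | 21 => 15 | 13 => 16 | 22 => 16 | 14 => 17 | _ => 17

/-- `ω_{kOf s}` has the degree of `s`. [cite: ConnerHarperLandsberg2023, §4 and §7.2] -/
theorem wdeg_kOf : ∀ s : A2 × B23, wdeg (kOf s) = deg2 s := by decide

/-- `ω_{kOf s}` is supported in the degree class of `s`. [cite: ConnerHarperLandsberg2023, §4 and §7.2] -/
theorem deg2_eq_of_wvZ_kOf_ne_zero :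
    ∀ s s' : A2 × B23, wvZ (kOf s) s' ≠ 0 → deg2 s' = deg2 s := by
  decide

/-- `ω_{kOf s}` does not vanish at `s`. [cite: ConnerHarperLandsberg2023, §4 and §7.2] -/
theorem wvZ_kOf_self_ne_zero : ∀ s : A2 × B23, wvZ (kOf s) s ≠ 0 := by decide

/-- The partner `((i, 1−j'), (1−j, k))` of a coordinate `((i, j), (j', k))` (meaningful on the
diagonal `j = j'`). [cite: ConnerHarperLandsberg2023, §4 and §7.2] -/
def partner (s : A2 × B23) : A2 × B23 := ((s.1.1, s.2.1.rev), (s.1.2.rev, s.2.2))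

/-- Two distinct coordinates of the same degree are partners …
[cite: ConnerHarperLandsberg2023, §4 and §7.2] -/
theorem eq_partner_of_deg2_eq :
    ∀ s s' : A2 × B23, s' ≠ s → deg2 s' = deg2 s → s' = partner s := by
  decide

/-- … and lie on the diagonal `j = j'`. [cite: ConnerHarperLandsberg2023, §4 and §7.2] -/
theorem diag_of_deg2_eq : ∀ s s' : A2 × B23, s' ≠ s → deg2 s' = deg2 s → s.1.2 = s.2.1 := by
  decide

/-- On the partner coordinate the weight vector takes the opposite value.
[cite: ConnerHarperLandsberg2023, §4 and §7.2] -/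
theorem wvZ_kOf_partner : ∀ s s' : A2 × B23, s' ≠ s → deg2 s' = deg2 s →
    wvZ (kOf s) s' = -wvZ (kOf s) s := by
  decide

/-- The degrees of the `18` weight lines are pairwise distinct (the grading separates the weight
lines of `U* ⊗ 𝔰𝔩(V) ⊗ W`). [cite: ConnerHarperLandsberg2023, §2.5 and §7.2] -/
theorem eq_of_wdeg_eq : ∀ k k' : Fin 18, wdeg k = wdeg k' → k = k' := by decide

/-- The two diagonal coordinates of an output pair have the same degree (so `M_⟨223⟩(C*)^⊥` is
graded). [cite: ConnerHarperLandsberg2023, §4 and §7.2] -/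
theorem deg2_diag : ∀ (i : Fin 2) (k : Fin 3), deg2 ((i, 0), (0, k)) = deg2 ((i, 1), (1, k)) := by
  decide

/-- Degree windows. [cite: ConnerHarperLandsberg2023, §2.5] -/
theorem deg2_window : ∀ s : A2 × B23, -3 ≤ deg2 s ∧ deg2 s < -3 + (18 : ℕ) := by decide

/-- Degree windows. [cite: ConnerHarperLandsberg2023, §2.5] -/
theorem deg3A_window : ∀ t : A2 × A2 × B23, -6 ≤ deg3A t ∧ deg3A t < -6 + (30 : ℕ) := by
  decide +kernel

/-- Degree windows. [cite: ConnerHarperLandsberg2023, §2.5] -/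
theorem deg3B_window : ∀ t : A2 × B23 × B23, -3 ≤ deg3B t ∧ deg3B t < -3 + (23 : ℕ) := by
  decide +kernel

/-- The weight degrees, shifted by `3`, form a permutation of `0..17`.
[cite: ConnerHarperLandsberg2023, §2.5] -/
def wdegIdx (k : Fin 18) : Fin 18 := ⟨(wdeg k + 3).toNat % 18, Nat.mod_lt _ (by decide)⟩

/-- `wdegIdx` is a bijection. [cite: ConnerHarperLandsberg2023, §2.5] -/
theorem wdegIdx_bijective : Function.Bijective wdegIdx := by decide

/-- `wdeg k = -3 + wdegIdx k`. [cite: ConnerHarperLandsberg2023, §2.5] -/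
theorem wdeg_eq_wdegIdx : ∀ k : Fin 18, wdeg k = -3 + ((wdegIdx k : ℕ) : ℤ) := by decide

/-- The partner of `((i,0),(0,k))`. [cite: ConnerHarperLandsberg2023, §4] -/
theorem partner_diag0 : ∀ (i : Fin 2) (k : Fin 3), partner ((i, 0), (0, k)) = ((i, 1), (1, k)) := by
  decide

/-- The partner of `((i,1),(1,k))`. [cite: ConnerHarperLandsberg2023, §4] -/
theorem partner_diag1 : ∀ (i : Fin 2) (k : Fin 3), partner ((i, 1), (1, k)) = ((i, 0), (0, k)) := by
  decide

/-- Shift windows for the `(210)` products. [cite: ConnerHarperLandsberg2023, §2.5 and §3] -/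
theorem wdeg_add_degA_window : ∀ (k : Fin 18) (a₀ : A2),
    -6 ≤ wdeg k + degA a₀ ∧ wdeg k + degA a₀ < -6 + (30 : ℕ) := by decide

/-- Shift windows for the `(120)` products. [cite: ConnerHarperLandsberg2023, §2.5 and §3] -/
theorem wdeg_add_degB_window : ∀ (k : Fin 18) (b₀ : B23),
    -3 ≤ wdeg k + degB b₀ ∧ wdeg k + degB b₀ < -3 + (23 : ℕ) := by decide

/-- `deg3A` splits off the middle slot. [cite: ConnerHarperLandsberg2023, §2.5] -/
theorem deg3A_eq₁ (t : A2 × A2 × B23) : deg3A t = deg2 (t.1, t.2.2) + degA t.2.1 := by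
  unfold deg3A deg2
  ring

/-- `deg3A` splits off the first slot. [cite: ConnerHarperLandsberg2023, §2.5] -/
theorem deg3A_eq₂ (t : A2 × A2 × B23) : deg3A t = deg2 (t.2.1, t.2.2) + degA t.1 := by
  unfold deg3A deg2
  ring

/-- `deg3B` splits off the last slot. [cite: ConnerHarperLandsberg2023, §2.5] -/
theorem deg3B_eq₁ (t : A2 × B23 × B23) : deg3B t = deg2 (t.1, t.2.1) + degB t.2.2 := by
  unfold deg3B deg2
  ring

/-- `deg3B` splits off the middle slot. [cite: ConnerHarperLandsberg2023, §2.5] -/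
theorem deg3B_eq₂ (t : A2 × B23 × B23) : deg3B t = deg2 (t.1, t.2.2) + degB t.2.1 := by
  unfold deg3B deg2
  ring

/-! ## `M_⟨223⟩(C*)^⊥` and its graded pieces -/

section Ann

variable (K : Type u) [Field K]

/-- `φ ∈ M_⟨223⟩(C*)^⊥` iff `φ(X_{i0} ⊗ Y_{0k}) + φ(X_{i1} ⊗ Y_{1k}) = 0` for all `i < 2`, `k < 3`
(the slices of `⟨2,2,3⟩` are `∑_j x_{ij} ⊗ y_{jk}`).
[cite: ConnerHarperLandsberg2023, §4 (M(C*) = U* ⊗ Id_V ⊗ W)] -/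
theorem mem_annSub_matMul_iff (φ : A2 × B23 → K) :
    φ ∈ annSub (matMulTensor K 2 2 3) ↔
      ∀ (i : Fin 2) (k : Fin 3), φ ((i, 0), (0, k)) + φ ((i, 1), (1, k)) = 0 := by
  rw [mem_annSub]
  constructor
  · intro h i k
    have := h (i, k)
    fin_cases i <;> fin_cases k <;>
      simpa [Fintype.sum_prod_type, Fin.sum_univ_two, Fin.sum_univ_three, matMulTensor] using this
  · rintro h ⟨i, k⟩
    have := h i k
    fin_cases i <;> fin_cases k <;>
      simpa [Fintype.sum_prod_type, Fin.sum_univ_two, Fin.sum_univ_three, matMulTensor] using this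

/-- `M_⟨223⟩(C*)^⊥` is graded for `deg2`. [cite: ConnerHarperLandsberg2023, §4 and §7.2] -/
theorem projDeg_mem_annSub {φ : A2 × B23 → K} (hφ : φ ∈ annSub (matMulTensor K 2 2 3)) (d : ℤ) :
    projDeg deg2 d φ ∈ annSub (matMulTensor K 2 2 3) := by
  rw [mem_annSub_matMul_iff] at hφ ⊢
  intro i k
  simp only [projDeg_apply]
  rw [← deg2_diag i k]
  split_ifs
  · exact hφ i k
  · exact add_zero 0

/-- The annihilator equation along a diagonal coordinate and its partner.
[cite: ConnerHarperLandsberg2023, §4] -/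
theorem apply_add_apply_partner {φ : A2 × B23 → K} (hφ : φ ∈ annSub (matMulTensor K 2 2 3))
    {s : A2 × B23} (hs : s.1.2 = s.2.1) : φ s + φ (partner s) = 0 := by
  rw [mem_annSub_matMul_iff] at hφ
  obtain ⟨⟨i, j⟩, ⟨j', k⟩⟩ := s
  simp only at hs
  subst hs
  fin_cases j
  · simpa [partner_diag0] using hφ i k
  · simpa [partner_diag1, add_comm] using hφ i k

variable [CharZero K]

/-- **The graded pieces of `M_⟨223⟩(C*)^⊥` are the weight lines**: a nonzero homogeneous element
of `M_⟨223⟩(C*)^⊥` of degree `d` is proportional to the weight vector `ω_k` with `wdeg k = d`.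
[cite: ConnerHarperLandsberg2023, §4 and §7.2 (U* ⊗ sl(V) ⊗ W)] -/
theorem exists_wv_eq_smul {φ : A2 × B23 → K} (hann : φ ∈ annSub (matMulTensor K 2 2 3)) {d : ℤ}
    (hhom : ∀ s, deg2 s ≠ d → φ s = 0) {s₀ : A2 × B23} (hs₀ : φ s₀ ≠ 0) :
    wdeg (kOf s₀) = d ∧ ∃ c : K, c ≠ 0 ∧ wv K (kOf s₀) = c • φ := by
  have hd : deg2 s₀ = d := by
    by_contra h
    exact hs₀ (hhom s₀ h)
  have hw0 : (wvZ (kOf s₀) s₀ : K) ≠ 0 := Int.cast_ne_zero.2 (wvZ_kOf_self_ne_zero s₀)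
  refine ⟨(wdeg_kOf s₀).trans hd, (wvZ (kOf s₀) s₀ : K) / φ s₀, div_ne_zero hw0 hs₀, ?_⟩
  funext s
  simp only [wv, Pi.smul_apply, smul_eq_mul]
  by_cases hdeg : deg2 s = deg2 s₀
  · by_cases hs : s = s₀
    · subst hs
      field_simp
    · have hp := eq_partner_of_deg2_eq s₀ s hs hdeg
      have hdiag := diag_of_deg2_eq s₀ s hs hdeg
      have hw := wvZ_kOf_partner s₀ s hs hdeg
      have hφ := apply_add_apply_partner K hann hdiag
      rw [← hp] at hφ
      have hφs : φ s = -φ s₀ := by linear_combination hφ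
      rw [hw, hφs]
      push_cast
      field_simp
  · have h1 : wvZ (kOf s₀) s = 0 := by
      by_contra h
      exact hdeg (deg2_eq_of_wvZ_kOf_ne_zero s₀ s h)
    have h2 : φ s = 0 := hhom s (hd ▸ hdeg)
    simp [h1, h2]

variable {K}

/-- **`in_{wdeg k}(F) ≤ K ω_k`, with `ω_k ∈ in_{wdeg k}(F)` unless the piece vanishes**, for any
`F ≤ M_⟨223⟩(C*)^⊥`. [cite: ConnerHarperLandsberg2023, §2.4 and §7.2] -/
theorem inPart_wdeg_le {F : Submodule K (A2 × B23 → K)} (hF : F ≤ annSub (matMulTensor K 2 2 3))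
    (k : Fin 18) {φ : A2 × B23 → K} (hφ : φ ∈ inPart deg2 F (wdeg k)) (hφ0 : φ ≠ 0) :
    wv K k ∈ inPart deg2 F (wdeg k) ∧ φ ∈ K ∙ wv K k := by
  have hann : φ ∈ annSub (matMulTensor K 2 2 3) :=
    inPart_le_of_graded deg2 hF (fun d ψ hψ => projDeg_mem_annSub K hψ d) (wdeg k) hφ
  have hhom : ∀ s, deg2 s ≠ wdeg k → φ s = 0 := fun s hs => apply_eq_zero_of_mem_inPart deg2 hφ hs
  obtain ⟨s₀, hs₀⟩ : ∃ s₀, φ s₀ ≠ 0 := by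
    by_contra h
    push Not at h
    exact hφ0 (funext h)
  obtain ⟨hdeg, c, hc, hwv⟩ := exists_wv_eq_smul K hann hhom hs₀
  obtain rfl : kOf s₀ = k := eq_of_wdeg_eq _ _ hdeg
  refine ⟨hwv ▸ Submodule.smul_mem _ c hφ, ?_⟩
  rw [Submodule.mem_span_singleton]
  exact ⟨c⁻¹, by rw [hwv, smul_smul, inv_mul_cancel₀ hc, one_smul]⟩

open scoped Classical in
/-- `dim in_{wdeg k}(F) ≤ [ω_k ∈ in_{wdeg k}(F)]`. [cite: ConnerHarperLandsberg2023, §2.4 and §7.2] -/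
theorem finrank_inPart_wdeg_le {F : Submodule K (A2 × B23 → K)}
    (hF : F ≤ annSub (matMulTensor K 2 2 3)) (k : Fin 18) :
    Module.finrank K (inPart deg2 F (wdeg k)) ≤
      if wv K k ∈ inPart deg2 F (wdeg k) then 1 else 0 := by
  by_cases hbot : inPart deg2 F (wdeg k) = ⊥
  · rw [hbot, finrank_bot]
    exact Nat.zero_le _
  · obtain ⟨φ, hφ, hφ0⟩ := (Submodule.ne_bot_iff _).1 hbot
    obtain ⟨hwv, -⟩ := inPart_wdeg_le hF k hφ hφ0
    rw [if_pos hwv]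
    have hle : inPart deg2 F (wdeg k) ≤ K ∙ wv K k := fun ψ hψ => by
      by_cases h0 : ψ = 0
      · rw [h0]; exact Submodule.zero_mem _
      · exact (inPart_wdeg_le hF k hψ h0).2
    calc Module.finrank K (inPart deg2 F (wdeg k)) ≤ Module.finrank K (K ∙ wv K k) :=
          Submodule.finrank_mono hle
      _ ≤ 1 := by
          rw [LinearMap.span_singleton_eq_range]
          exact (LinearMap.finrank_range_le _).trans (Module.finrank_self K).le

open scoped Classical in
/-- **A subspace `F ≤ M_⟨223⟩(C*)^⊥` degenerates onto at least `dim F` weight lines**: the set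
`S_F = {k : ω_k ∈ in_{wdeg k}(F)}` has `|S_F| ≥ dim F`.
[cite: ConnerHarperLandsberg2023, §2.4 and §7.2] -/
theorem finrank_le_card_weightLines {F : Submodule K (A2 × B23 → K)}
    (hF : F ≤ annSub (matMulTensor K 2 2 3)) :
    Module.finrank K F ≤
      (Finset.univ.filter fun k : Fin 18 => wv K k ∈ inPart deg2 F (wdeg k)).card := by
  have hsum := finrank_eq_sum_finrank_inPart deg2 F (-3) 18 (fun s => (deg2_window s).1)
    (fun s => (deg2_window s).2)
  rw [hsum, ← Fin.sum_univ_eq_sum_range]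
  set e := Equiv.ofBijective wdegIdx wdegIdx_bijective
  rw [← e.sum_comp]
  have hterm : ∀ k : Fin 18, Module.finrank K (inPart deg2 F (-3 + ((e k : Fin 18) : ℕ))) =
      Module.finrank K (inPart deg2 F (wdeg k)) := fun k => by
    rw [wdeg_eq_wdegIdx k]; rfl
  simp only [hterm]
  calc ∑ k, Module.finrank K (inPart deg2 F (wdeg k))
      ≤ ∑ k : Fin 18, (if wv K k ∈ inPart deg2 F (wdeg k) then 1 else 0) :=
        Finset.sum_le_sum fun k _ => finrank_inPart_wdeg_le hF k
    _ = _ := Finset.sum_boole _ _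

end Ann

/-! ## Homogeneity of the test products -/

section Homog

variable (K : Type u) [Field K]

/-- The `(210)` product with `e_{a₀}` maps `V_{≥d}` into `V_{≥ d + deg a₀}`.
[cite: ConnerHarperLandsberg2023, §2.5 and §3] -/
theorem mul210_mem_Vge (a₀ : A2) (d : ℤ) (φ : A2 × B23 → K) (hφ : φ ∈ Vge deg2 d) :
    MatMulTwo.mul210 K a₀ φ ∈ Vge deg3A (d + degA a₀) := by
  rw [mem_Vge] at hφ ⊢
  intro t ht
  simp only [MatMulTwo.mul210_apply, MatMulTwo.mul210Fun]
  have h1 : (if t.2.1 = a₀ then φ (t.1, t.2.2) else 0) = 0 := by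
    split_ifs with h
    · apply hφ; have := deg3A_eq₁ t; rw [h] at this; omega
    · rfl
  have h2 : (if t.1 = a₀ then φ (t.2.1, t.2.2) else 0) = 0 := by
    split_ifs with h
    · apply hφ; have := deg3A_eq₂ t; rw [h] at this; omega
    · rfl
  rw [h1, h2, add_zero]

/-- The `(210)` product intertwines the degree projections.
[cite: ConnerHarperLandsberg2023, §2.5 and §3] -/
theorem projDeg_mul210 (a₀ : A2) (d : ℤ) (φ : A2 × B23 → K) :
    projDeg deg3A (d + degA a₀) (MatMulTwo.mul210 K a₀ φ) =
      MatMulTwo.mul210 K a₀ (projDeg deg2 d φ) := by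
  funext t
  have e₁ := deg3A_eq₁ t
  have e₂ := deg3A_eq₂ t
  simp only [projDeg_apply, MatMulTwo.mul210_apply, MatMulTwo.mul210Fun]
  by_cases hB : t.2.1 = a₀ <;> by_cases hC : t.1 = a₀
  · rw [if_pos hB, if_pos hC, if_pos hB, if_pos hC]
    rw [hB] at e₁
    rw [hC] at e₂
    by_cases hd : deg2 (t.1, t.2.2) = d
    · rw [if_pos (show deg3A t = d + degA a₀ by omega), if_pos hd,
        if_pos (show deg2 (t.2.1, t.2.2) = d by omega)]
    · rw [if_neg (show ¬deg3A t = d + degA a₀ by omega), if_neg hd,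
        if_neg (show ¬deg2 (t.2.1, t.2.2) = d by omega), add_zero]
  · rw [if_pos hB, if_neg hC, if_pos hB, if_neg hC, add_zero, add_zero]
    rw [hB] at e₁
    by_cases hd : deg2 (t.1, t.2.2) = d
    · rw [if_pos (show deg3A t = d + degA a₀ by omega), if_pos hd]
    · rw [if_neg (show ¬deg3A t = d + degA a₀ by omega), if_neg hd]
  · rw [if_neg hB, if_pos hC, if_neg hB, if_pos hC, zero_add, zero_add]
    rw [hC] at e₂
    by_cases hd : deg2 (t.2.1, t.2.2) = d
    · rw [if_pos (show deg3A t = d + degA a₀ by omega), if_pos hd]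
    · rw [if_neg (show ¬deg3A t = d + degA a₀ by omega), if_neg hd]
  · rw [if_neg hB, if_neg hC, if_neg hB, if_neg hC, add_zero, ite_self]

/-- The `(120)` product with `e_{b₀}` maps `V_{≥d}` into `V_{≥ d + deg b₀}`.
[cite: ConnerHarperLandsberg2023, §2.5 and §3] -/
theorem mul120_mem_Vge (b₀ : B23) (d : ℤ) (φ : A2 × B23 → K) (hφ : φ ∈ Vge deg2 d) :
    MatMulTwo.mul120 K b₀ φ ∈ Vge deg3B (d + degB b₀) := by
  rw [mem_Vge] at hφ ⊢
  intro t ht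
  simp only [MatMulTwo.mul120_apply, MatMulTwo.mul120Fun]
  have h1 : (if t.2.2 = b₀ then φ (t.1, t.2.1) else 0) = 0 := by
    split_ifs with h
    · apply hφ; have := deg3B_eq₁ t; rw [h] at this; omega
    · rfl
  have h2 : (if t.2.1 = b₀ then φ (t.1, t.2.2) else 0) = 0 := by
    split_ifs with h
    · apply hφ; have := deg3B_eq₂ t; rw [h] at this; omega
    · rfl
  rw [h1, h2, add_zero]

/-- The `(120)` product intertwines the degree projections.
[cite: ConnerHarperLandsberg2023, §2.5 and §3] -/
theorem projDeg_mul120 (b₀ : B23) (d : ℤ) (φ : A2 × B23 → K) :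
    projDeg deg3B (d + degB b₀) (MatMulTwo.mul120 K b₀ φ) =
      MatMulTwo.mul120 K b₀ (projDeg deg2 d φ) := by
  funext t
  have e₁ := deg3B_eq₁ t
  have e₂ := deg3B_eq₂ t
  simp only [projDeg_apply, MatMulTwo.mul120_apply, MatMulTwo.mul120Fun]
  by_cases hB : t.2.2 = b₀ <;> by_cases hC : t.2.1 = b₀
  · rw [if_pos hB, if_pos hC, if_pos hB, if_pos hC]
    rw [hB] at e₁
    rw [hC] at e₂
    by_cases hd : deg2 (t.1, t.2.1) = d
    · rw [if_pos (show deg3B t = d + degB b₀ by omega), if_pos hd,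
        if_pos (show deg2 (t.1, t.2.2) = d by omega)]
    · rw [if_neg (show ¬deg3B t = d + degB b₀ by omega), if_neg hd,
        if_neg (show ¬deg2 (t.1, t.2.2) = d by omega), add_zero]
  · rw [if_pos hB, if_neg hC, if_pos hB, if_neg hC, add_zero, add_zero]
    rw [hB] at e₁
    by_cases hd : deg2 (t.1, t.2.1) = d
    · rw [if_pos (show deg3B t = d + degB b₀ by omega), if_pos hd]
    · rw [if_neg (show ¬deg3B t = d + degB b₀ by omega), if_neg hd]
  · rw [if_neg hB, if_pos hC, if_neg hB, if_pos hC, zero_add, zero_add]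
    rw [hC] at e₂
    by_cases hd : deg2 (t.1, t.2.2) = d
    · rw [if_pos (show deg3B t = d + degB b₀ by omega), if_pos hd]
    · rw [if_neg (show ¬deg3B t = d + degB b₀ by omega), if_neg hd]
  · rw [if_neg hB, if_neg hC, if_neg hB, if_neg hC, add_zero, ite_self]

end Homog

end MatMul223

end Literature.Computability.AlgebraicComplexity

end
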